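import Summits.ValiantsHypothesis.ValiantsHypothesis.Theorems.MonotoneRestorationOrbitRestorationQPTermCircuitWf
import HarnessLib

/-!
# The reduced term circuit: the designed action of the variable symmetries

Route MonotoneRestoration, crux `OrbitRestorationQP` (stmt-ValiantsHypothesis-18293) — K3 machinery, namespace
`Summit.ValiantsHypothesis.ValiantsHypothesis.Theorems.TermCircuit`.  For a group `Γ` acting on the variables `X`
and a `Γ`-STABLE closed universe of normal terms (`HTerm.act γ` maps members to members), the induced permutation of the gates (`perm γ`: node-terms and the copies `Sc`/`Pl` move with
their term, variables move, constants and `Zr` are fixed) is a circuit automorphism over `γ`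
(Dawar–Wilsenach Def. 3.6; `perm_isAutomorphismExtending`) as soon as the root is `Γ`-fixed; so the reduced
term circuit is `Γ`-symmetric (Def. 3.7) with a DESIGNED automorphism over every `γ`.  The key step is that
the wiring of a sum node depends only on the MULTISET of its children (counted with `List.count`), which
`act γ` permutes.  Everything is proved. [folklore]

## References
* A. Dawar, G. Wilsenach, *Symmetric arithmetic circuits*, ToC 21 (2025), Defs. 2.2, 3.6, 3.7, §3.3
  (`Orb`, `ORB`). [DawarWilsenach2025]
* A. Dawar, G. Wilsenach, *Symmetric circuits for rank logic*, ACM ToCL 23 (2021/22), §3 (syntactic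
  equivalence, reduced circuits, unique extensions). [DawarWilsenach2021]
* A. Dawar, B. Pago, T. Seppelt, *Symmetric algebraic circuits and homomorphism polynomials*,
  arXiv:2502.06740 (2025), §5. [DawarPagoSeppelt2025]
-/

noncomputable section

open scoped Classical

-- `Summit.ValiantsHypothesis.ValiantsHypothesis.…` is the tree's single-conjunct layout (Sub = Summit).
set_option linter.dupNamespace false

namespace Summit.ValiantsHypothesis.ValiantsHypothesis.Theorems

open Literature.Computability.AlgebraicComplexity

namespace TermCircuit

open HTerm

universe u v

variable {K : Type u} {X : Type v} [CommSemiring K] (𝒰 : Universe K X)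
variable {Γ : Type*} [Group Γ] [MulAction Γ X]

/-! ### The designed action of `Γ` on the gates -/

/-- `act γ` on the members. [folklore] -/
def actT (hS : ∀ (γ : Γ) (t : HTerm K X), t ∈ 𝒰.T → act γ t ∈ 𝒰.T) (γ : Γ) (t : ↥𝒰.T) : ↥𝒰.T := ⟨act γ t.1, hS γ t.1 t.2⟩

omit [CommSemiring K] in
/-- `act γ` maps node-terms of the universe to node-terms. [folklore] -/
theorem act_mem_nodes (hS : ∀ (γ : Γ) (t : HTerm K X), t ∈ 𝒰.T → act γ t ∈ 𝒰.T) (γ : Γ) {t : HTerm K X} (ht : t ∈ nodes 𝒰) : act γ t ∈ nodes 𝒰 := by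
  obtain ⟨b, l, rfl⟩ := exists_eq_node_of_mem_nodes 𝒰 ht
  rw [act_node]
  exact node_mem_nodes 𝒰 (act_node γ b l ▸ hS γ _ (mem_T_of_mem_nodes 𝒰 ht))

/-- `act γ` on the node-terms. [folklore] -/
def actN (hS : ∀ (γ : Γ) (t : HTerm K X), t ∈ 𝒰.T → act γ t ∈ 𝒰.T) (γ : Γ) (t : ↥(nodes 𝒰)) : ↥(nodes 𝒰) := ⟨act γ t.1, act_mem_nodes 𝒰 hS γ t.2⟩

omit [CommSemiring K] in
/-- `act γ⁻¹` undoes `act γ` on members (normal forms). [folklore] -/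
theorem act_inv_act (γ : Γ) {t : HTerm K X} (ht : t ∈ 𝒰.T) : act γ⁻¹ (act γ t) = t := by
  rw [← act_mul, inv_mul_cancel, act_one, 𝒰.normal t ht]

/-- The designed action of `γ` on the gates, as a map. [folklore] -/
def permFun (hS : ∀ (γ : Γ) (t : HTerm K X), t ∈ 𝒰.T → act γ t ∈ 𝒰.T) (γ : Γ) : Gate 𝒰 → Gate 𝒰
  | Gate.V x => Gate.V (γ • x)
  | Gate.C c => Gate.C c
  | Gate.T t => Gate.T (actN 𝒰 hS γ t)
  | Gate.Sc m u => Gate.Sc m (actT 𝒰 hS γ u)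
  | Gate.Pl u => Gate.Pl (actT 𝒰 hS γ u)
  | Gate.Zr => Gate.Zr

/-- `permFun γ⁻¹` is a left inverse of `permFun γ`. [folklore] -/
theorem permFun_inv_apply (hS : ∀ (γ : Γ) (t : HTerm K X), t ∈ 𝒰.T → act γ t ∈ 𝒰.T) (γ : Γ) (g : Gate 𝒰) : permFun 𝒰 hS γ⁻¹ (permFun 𝒰 hS γ g) = g := by
  cases g with
  | V x => simp [permFun]
  | C c => rfl
  | T t => exact congrArg Gate.T (Subtype.ext (act_inv_act 𝒰 γ (mem_T_of_mem_nodes 𝒰 t.2)))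
  | Sc m u => exact congrArg (Gate.Sc m) (Subtype.ext (act_inv_act 𝒰 γ u.2))
  | Pl u => exact congrArg Gate.Pl (Subtype.ext (act_inv_act 𝒰 γ u.2))
  | Zr => rfl

/-- **The designed automorphism** of the gates over `γ`. [folklore] -/
def perm (hS : ∀ (γ : Γ) (t : HTerm K X), t ∈ 𝒰.T → act γ t ∈ 𝒰.T) (γ : Γ) : Equiv.Perm (Gate 𝒰) where
  toFun := permFun 𝒰 hS γ
  invFun := permFun 𝒰 hS γ⁻¹
  left_inv := permFun_inv_apply 𝒰 hS γ
  right_inv g := by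
    have := permFun_inv_apply 𝒰 hS γ⁻¹ g
    rwa [inv_inv] at this

/-- `perm γ` on the gate of a member term. [folklore] -/
theorem perm_gateOf (hS : ∀ (γ : Γ) (t : HTerm K X), t ∈ 𝒰.T → act γ t ∈ 𝒰.T) (γ : Γ) {u : HTerm K X} (hu : u ∈ 𝒰.T) :
    perm 𝒰 hS γ (gateOf 𝒰 u) = gateOf 𝒰 (act γ u) := by
  change permFun 𝒰 hS γ (gateOf 𝒰 u) = _
  cases u with
  | var x =>
    have : act γ (var x : HTerm K X) = var (γ • x) := by simp [act, HTerm.rename]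
    rw [this]; rfl
  | const c =>
    have : act γ (const c : HTerm K X) = const c := by simp [act, HTerm.rename]
    rw [this, gateOf_const 𝒰 hu]; rfl
  | node b l =>
    rw [gateOf_node 𝒰 hu]
    have hmem : act γ (node b l) ∈ 𝒰.T := hS γ _ hu
    rw [act_node] at hmem ⊢
    rw [gateOf_node 𝒰 hmem]
    simp only [permFun]
    congr 1
    exact Subtype.ext (act_node γ b l)

/-- `perm γ` on a representative. [folklore] -/
theorem perm_rep (hS : ∀ (γ : Γ) (t : HTerm K X), t ∈ 𝒰.T → act γ t ∈ 𝒰.T) (γ : Γ) {u : HTerm K X} (hu : u ∈ 𝒰.T) {m : ℕ} (hm1 : 1 ≤ m) (hmM : m ≤ 𝒰.M) :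
    perm 𝒰 hS γ (rep 𝒰 u m) = rep 𝒰 (act γ u) m := by
  by_cases h1 : m = 1
  · subst h1; rw [rep_one, rep_one, perm_gateOf 𝒰 hS γ hu]
  · rw [rep_of_ne_one 𝒰 hu h1 hmM, rep_of_ne_one 𝒰 (hS γ u hu) h1 hmM]; rfl

omit [CommSemiring K] in
/-- Counting a member after acting: `act γ` is injective on the universe. [folklore] -/
theorem count_map_act (γ : Γ) {l : List (HTerm K X)} (hl : ∀ u ∈ l, u ∈ 𝒰.T) {u : HTerm K X}
    (hu : u ∈ l) : (l.map (act γ)).count (act γ u) = l.count u := by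
  rw [← Multiset.coe_count, ← Multiset.coe_count, ← Multiset.map_coe]
  refine Multiset.count_map_eq_count _ _ (fun a ha b hb hab => ?_) u (by simpa using hu)
  exact act_injective_of_normal γ (𝒰.normal a (hl a (by simpa using ha)))
    (𝒰.normal b (hl b (by simpa using hb))) hab

/-- **Wires go to wires** under the designed action. [folklore] -/
theorem children_perm (hS : ∀ (γ : Γ) (t : HTerm K X), t ∈ 𝒰.T → act γ t ∈ 𝒰.T) (γ : Γ) (g : Gate 𝒰) :
    children 𝒰 (perm 𝒰 hS γ g) = (children 𝒰 g).map (perm 𝒰 hS γ).toEmbedding := by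
  rw [Finset.map_eq_image, Equiv.coe_toEmbedding]
  cases g with
  | V x => rfl
  | C c => rfl
  | T t =>
    obtain ⟨t, ht⟩ := t
    obtain ⟨b, l, rfl⟩ := exists_eq_node_of_mem_nodes 𝒰 ht
    have hT := mem_T_of_mem_nodes 𝒰 ht
    have hl : ∀ u ∈ l, u ∈ 𝒰.T := 𝒰.closed b l hT
    have hact : (actN 𝒰 hS γ ⟨node b l, ht⟩).1 = node b (tsort (l.map (act γ))) := act_node γ b l
    change children 𝒰 (Gate.T (actN 𝒰 hS γ ⟨node b l, ht⟩)) = _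
    cases b with
    | false =>
      rw [children_T_sum 𝒰 _ _ hact, children_T_sum 𝒰 ⟨_, ht⟩ l rfl, toFinset_map_gate,
        toFinset_map_gate, Finset.image_image,
        List.toFinset_eq_of_perm _ _ (tsort_perm _), toFinset_map_term, Finset.image_image]
      refine Finset.image_congr fun u hu => ?_
      have hu' : u ∈ l := List.mem_toFinset.1 hu
      simp only [Function.comp]
      rw [(tsort_perm (l.map (act γ))).count_eq, count_map_act 𝒰 γ hl hu',
        perm_rep 𝒰 hS γ (hl u hu') (List.count_pos_iff.2 hu')
          (𝒰.count_le l hT u)]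
    | true =>
      have hlen := 𝒰.binary l hT
      obtain ⟨a, c, rfl⟩ := List.length_eq_two.1 hlen
      have ha : a ∈ 𝒰.T := hl a (by simp)
      have hc : c ∈ 𝒰.T := hl c (by simp)
      have hmap : List.map (act γ) [a, c] = [act γ a, act γ c] := rfl
      rw [hmap] at hact
      rw [children_T_prod 𝒰 _ _ hact, children_T_prod 𝒰 ⟨_, ht⟩ [a, c] rfl,
        sqElem_eq_of_perm_pair (tsort_perm [act γ a, act γ c]), sqElem_pair]
      by_cases hac : a = c
      · subst hac
        simp only [if_true, dif_pos ha, dif_pos (hS γ a ha), Finset.image_insert,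
          Finset.image_singleton, perm_gateOf 𝒰 hS γ ha]
        rfl
      · have hac' : act γ a ≠ act γ c := fun h =>
          hac (act_injective_of_normal γ (𝒰.normal a ha) (𝒰.normal c hc) h)
        rw [if_neg hac, if_neg hac', ← hmap, toFinset_map_gate, toFinset_map_gate,
          List.toFinset_eq_of_perm _ _ (tsort_perm (List.map (act γ) [a, c])),
          toFinset_map_term, Finset.image_image, Finset.image_image]
        refine Finset.image_congr fun u hu => ?_
        have hu' : u ∈ [a, c] := List.mem_toFinset.1 hu
        simp only [Function.comp]
        exact (perm_gateOf 𝒰 hS γ (hl u hu')).symm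
  | Sc m u =>
    change children 𝒰 (Gate.Sc m (actT 𝒰 hS γ u)) = _
    simp only [children, Finset.image_insert, Finset.image_singleton]
    rfl
  | Pl u =>
    change children 𝒰 (Gate.Pl (actT 𝒰 hS γ u)) = _
    simp only [children, Finset.image_insert, Finset.image_singleton, perm_gateOf 𝒰 hS γ u.2]
    rfl
  | Zr => rfl

/-- **Labels transform under `γ`.** [folklore] -/
theorem label_perm (hS : ∀ (γ : Γ) (t : HTerm K X), t ∈ 𝒰.T → act γ t ∈ 𝒰.T) (γ : Γ) (g : Gate 𝒰) : label 𝒰 (perm 𝒰 hS γ g) = γ • label 𝒰 g := by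
  cases g with
  | V x => rfl
  | C c => rfl
  | T t =>
    obtain ⟨t, ht⟩ := t
    obtain ⟨b, l, rfl⟩ := exists_eq_node_of_mem_nodes 𝒰 ht
    have hact : (actN 𝒰 hS γ ⟨node b l, ht⟩).1 = node b (tsort (l.map (act γ))) := act_node γ b l
    change label 𝒰 (Gate.T (actN 𝒰 hS γ ⟨node b l, ht⟩)) = _
    cases b
    · rw [label_T_sum 𝒰 _ _ hact, label_T_sum 𝒰 ⟨_, ht⟩ l rfl]; rfl
    · rw [label_T_prod 𝒰 _ _ hact, label_T_prod 𝒰 ⟨_, ht⟩ l rfl]; rfl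
  | Sc m u => rfl
  | Pl u => rfl
  | Zr => rfl

/-- **The designed action is by circuit automorphisms** (Dawar–Wilsenach Def. 3.6), provided the
root is `Γ`-fixed. [folklore] -/
theorem perm_isAutomorphismExtending (hS : ∀ (γ : Γ) (t : HTerm K X), t ∈ 𝒰.T → act γ t ∈ 𝒰.T) [MulAction Γ Unit] (hroot : ∀ γ : Γ, act γ 𝒰.root = 𝒰.root)
    (γ : Γ) : (circuit 𝒰).IsAutomorphismExtending γ (perm 𝒰 hS γ) := by
  refine ⟨children_perm 𝒰 hS γ, label_perm 𝒰 hS γ, fun _ => ?_⟩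
  change gateOf 𝒰 𝒰.root = perm 𝒰 hS γ (gateOf 𝒰 𝒰.root)
  rw [perm_gateOf 𝒰 hS γ 𝒰.root_mem, hroot]

/-- The reduced term circuit is `Γ`-symmetric (Def. 3.7). [folklore] -/
theorem circuit_isSymmetric (hS : ∀ (γ : Γ) (t : HTerm K X), t ∈ 𝒰.T → act γ t ∈ 𝒰.T) [MulAction Γ Unit] (hroot : ∀ γ : Γ, act γ 𝒰.root = 𝒰.root) :
    (circuit 𝒰).IsSymmetric Γ :=
  fun γ => ⟨perm 𝒰 hS γ, perm_isAutomorphismExtending 𝒰 hS hroot γ⟩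

end TermCircuit

end Summit.ValiantsHypothesis.ValiantsHypothesis.Theorems

end
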